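import Literature.NumberTheory.ConnesMoscovici2022.UVProlateSADomainStructure
import HarnessLib

/-!
# Connes–Moscovici 2022, Theorem 1.6: DISCHARGE (`CM22_thm_1_6_holds`) — eq. (1.15) as a theorem,
# `W_sa` commutes with the Fourier transform and with `P̂_λ`

LINE 1 — FRAMING. RH-FREE corpus literature (self-adjointness theory of the prolate wave operator
`W_λ = −∂ₓ(λ² − x²)∂ₓ + (2πλx)²` on `L²(ℝ)`; cell rh-crit C1, sequel row O2 `UVProlateSpectrum`, no
leaf / binder / K-path role).  bears_on: LADDER-RH W-C/W-P only, via the named fact `CM22_thm_1_6`.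
WHAT THIS IS NOT: any claim about `ζ` or RH — Fourier-invariance of a self-adjoint Sturm–Liouville
domain says nothing about zeta zeros; nothing here bears on the truth of RH.  Theorems only
(0 `def`s, 0 named facts, no `sorry`).

Source: A. Connes, H. Moscovici, *The UV prolate spectrum matches the zeros of zeta*, PNAS 119
(2022) [bib `ConnesMoscovici2022`] = arXiv:2112.05500, §1 (= arXiv §2; held text
`paper-arxiv-2112.05500`): eq. (1.15) `𝓛_β := ⋂± Ker L_{β±} ∩ ⋂± Ker L_{β̂±}` with
`L_θ = iΩ(·, θ)` (1.11) (chunk p0006:L1–L10); «the symplectic form `Ω` [is] globally invariant under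
the Fourier transform» (p0006:L38–L44); the Definition of `W_sa` (p0006:L52–L69); and **Theorem 1.6**
(= arXiv Thm 2.6, p0006:L76–L79; proof L81–L114): «(i) `W_sa` is selfadjoint and commutes with
the Fourier transform. (ii) `W_sa` commutes with the projections `P_λ` and `P̂_λ`. (iii) `W_sa` is
the only selfadjoint extension of `W_min` commuting with `P_λ` and `P̂_λ`. (iv) The spectrum of
`W_sa` is discrete and unbounded on both sides.»

## State of the tree before this file, and what is added

Seat cc-t8 g4's `UVProlateSADomainStructure` holds (i)-self-adjointness `isSelfAdjoint_prolateSA`,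
the structure theorem `prolateSADomain_eq_sup_span_beta`
(`𝓛_β = dom W_min ⊔ span{β₊, β₋, 𝓕β₊, 𝓕β₋}`), (iii) `CM22_thm_1_6_iii`, (iv) `CM22_thm_1_6_iv`, and
the socket `CM22_thm_1_6_of_fourier (hF) (hPhat) : CM22_thm_1_6` reducing the named fact to the two
Fourier clauses; seat cc-t14 g3's `CM22_thm_1_6_ii_cutoffProj` is the `P_λ`-half of (ii); seat
cc-t10's `UVProlateMaxDomainFourier` / `UVProlateFourierTestVectors` give `W_max 𝓕 = 𝓕 W_max`,
`Ω(𝓕ξ, η) = Ω(ξ, 𝓕⁻¹η)` and the four test vectors with their parities.  This file proves: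

* §1 **eq. (1.15) as a theorem** — `mem_prolateSASet_iff_omegaForm_beta_eq_zero`: for
  `ζ ∈ dom W_max`, `ζ ∈ 𝓛_β ↔ Ω(ζ, β₊) = Ω(ζ, β₋) = Ω(ζ, 𝓕β₊) = Ω(ζ, 𝓕β₋) = 0`, and
  `mem_prolateSASet_iff_forall_omegaForm_eq_zero` (`𝓛_β` is Lagrangian: its own `Ω`-orthogonal).
  The converse direction is ALGEBRAIC: `Ω(ζ, ·)` kills `dom W_min` and the four `β`'s, hence `𝓛_β`,
  so `ζ ∈ dom W_sa† = dom W_sa` by self-adjointness — no boundary analysis of a general element of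
  `dom W_max` is needed;
* §2 the `𝓕`- and `𝓕⁻¹`-images of the four `β`'s lie in `𝓛_β` (parity);
* §3 **Thm 1.6 (i), second clause — `commutesWith_prolateSA_fourierL2 : CommutesWith W_sa 𝓕`**:
  `ξ ∈ 𝓛_β ⇒ Ω(𝓕ξ, β) = Ω(ξ, 𝓕⁻¹β) = 0` for the four `β`'s, so `𝓕ξ ∈ 𝓛_β` by §1, and
  `W_sa(𝓕ξ) = W_max(𝓕ξ) = 𝓕 W_max ξ`; the same for `𝓕⁻¹`; `fourierL2_mem_prolateSASet_iff`;
* §4 **Thm 1.6 (ii), `P̂_λ`-half — `commutesWith_prolateSA_cutoffProjHat`** (`P̂_λ = 𝓕⁻¹ P_λ 𝓕` in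
  the tree, composed from §3 and the `P_λ`-half);
* §5 **`CM22_thm_1_6_holds : CM22_thm_1_6`** — the named fact DISCHARGED; clause-shaped corollaries
  `CM22_thm_1_6_i_fourier`, `CM22_thm_1_6_ii_cutoffProjHat`, and `isCompactOperator_resolvent_prolateSA`.

Cell rh-crit seat cc-t14 g4 (CM22 Thm 1.6 assembler, cc-lead R150/R152).  Nothing in this file bears
on the truth of RH.
-/

noncomputable section

open Complex Set MeasureTheory Filter SchwartzMap FourierTransform
open scoped Real Topology InnerProductSpace
open _root_.LinearPMap Literature.Analysis.UnboundedOperators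

namespace Literature.NumberTheory.ConnesMoscovici2022

open Literature.NumberTheory.ConnesConsani2021 Literature.NumberTheory.ConnesConsani2024

variable {lam : ℝ}

/-! ## §1. Eq. (1.15) as a theorem: `𝓛_β` is the `Ω`-annihilator of `β₊, β₋, 𝓕β₊, 𝓕β₋` -/

/-- The four test vectors lie in `dom W_max` (plumbing over seat cc-t8's `betaQuad_mem_prolateSASet`).
[cite: ConnesMoscovici2022, Lemma 1.5 setup: «`β₊ … belongs to P_λ𝒮(ℝ)` and hence to `Dom W_max`» (= arXiv:2112.05500 chunk p0005:L86)] -/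
theorem betaQuad_mem_prolateMax (hlam : 0 < lam) (k : Fin 4) :
    (![betaPlus lam hlam, betaMinus lam hlam, (𝓕 (betaPlus lam hlam) : L2R),
      (𝓕 (betaMinus lam hlam) : L2R)] : Fin 4 → L2R) k ∈ (prolateMax lam).domain :=
  (betaQuad_mem_prolateSASet hlam k).1

/-- `W_sa† = W_sa`. [cite: ConnesMoscovici2022, Thm 1.6 (i) (= arXiv:2112.05500 Thm 2.6 (i), chunk p0006:L76–L81)] -/
theorem adjoint_prolateSA (hlam : 0 < lam) : (prolateSA lam hlam)† = prolateSA lam hlam :=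
  LinearPMap.isSelfAdjoint_def.1 (isSelfAdjoint_prolateSA hlam)

/-- `Ω` vanishes on `𝓛_β × 𝓛_β` (`W_sa` is symmetric). [cite: ConnesMoscovici2022, §1 eq. (1.15) with (1.11) `L_θ = iΩ(·, θ)` and Lemma 1.2 (v) (= arXiv:2112.05500 (2.15), chunk p0006:L1–L10)] -/
theorem omegaForm_eq_zero_of_mem_prolateSASet (hlam : 0 < lam) {ξ η : L2R}
    (hξ : ξ ∈ prolateSASet lam) (hη : η ∈ prolateSASet lam) :
    omegaForm lam ⟨ξ, hξ.1⟩ ⟨η, hη.1⟩ = 0 := by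
  rw [omegaForm, inner_prolateMax_symm hlam hξ hη, sub_self, mul_zero]

/-- `Ω(ζ, β) = 0` for `ζ ∈ 𝓛_β` and each of the four `β`'s — the direction `𝓛_β ⊆ ⋂ Ker L_β` of
(1.15). [cite: ConnesMoscovici2022, §1 eq. (1.15) `𝓛_β = ⋂ Ker L_{β±} ∩ ⋂ Ker L_{β̂±}` (= arXiv:2112.05500 (2.15), chunk p0006:L1–L10)] -/
theorem omegaForm_betaQuad_eq_zero_of_mem_prolateSASet (hlam : 0 < lam) {ζ : L2R}
    (hζ : ζ ∈ prolateSASet lam) (k : Fin 4) :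
    omegaForm lam ⟨ζ, hζ.1⟩ ⟨(![betaPlus lam hlam, betaMinus lam hlam, (𝓕 (betaPlus lam hlam) : L2R),
      (𝓕 (betaMinus lam hlam) : L2R)] : Fin 4 → L2R) k, betaQuad_mem_prolateMax hlam k⟩ = 0 :=
  omegaForm_eq_zero_of_mem_prolateSASet hlam hζ (betaQuad_mem_prolateSASet hlam k)

/-- **(1.15), the converse direction — ALGEBRAIC**: an element `ζ ∈ dom W_max` with
`Ω(ζ, β₊) = Ω(ζ, β₋) = Ω(ζ, 𝓕β₊) = Ω(ζ, 𝓕β₋) = 0` lies in `𝓛_β`.  Indeed `Ω(ζ, ·)` then kills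
`dom W_min + span{β's} = 𝓛_β`, so `⟪W_max ζ, η⟫ = ⟪ζ, W_sa η⟫` for all `η ∈ dom W_sa`, i.e.
`ζ ∈ dom W_sa† = dom W_sa`. [cite: ConnesMoscovici2022, §1 eq. (1.15) and the Definition of `W_sa` («`Dom W_sa = 𝓛_β`»; the boundary conditions (1.19)–(1.21) «determine uniquely `Dom W_sa`») (= arXiv:2112.05500 (2.15), chunk p0006:L1–L10, L52–L69)] -/
theorem mem_prolateSASet_of_omegaForm_betaQuad_eq_zero (hlam : 0 < lam)
    (ζ : (prolateMax lam).domain)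
    (h : ∀ k : Fin 4, omegaForm lam ζ ⟨(![betaPlus lam hlam, betaMinus lam hlam,
      (𝓕 (betaPlus lam hlam) : L2R), (𝓕 (betaMinus lam hlam) : L2R)] : Fin 4 → L2R) k,
        betaQuad_mem_prolateMax hlam k⟩ = 0) :
    (ζ : L2R) ∈ prolateSASet lam := by
  -- `Ω(ζ, η) = 0` for every `η ∈ 𝓛_β`
  have hΩ : ∀ (η : L2R) (hη : η ∈ prolateSASet lam), omegaForm lam ζ ⟨η, hη.1⟩ = 0 := by
    intro η hη
    obtain ⟨m, hm, c, hmc⟩ := (mem_prolateSASet_iff_exists_add_sum hlam η).1 hη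
    rw [omegaForm_right_of_eq_add_sum _ (betaQuad_mem_prolateMax hlam) ζ hm c hmc hη.1]
    exact Finset.sum_eq_zero fun k _ ↦ by rw [h k, mul_zero]
  -- hence `ζ ∈ dom W_sa†`
  have hadj : (ζ : L2R) ∈ (prolateSA lam hlam)†.domain := by
    refine LinearPMap.mem_adjoint_domain_of_exists _ ⟨prolateMax lam ζ, fun η ↦ ?_⟩
    have hη : (η : L2R) ∈ prolateSASet lam := by
      rw [← mem_prolateSADomain hlam, ← prolateSA_domain hlam]; exact η.2
    have eη : (prolateSA lam hlam η : L2R) = prolateMax lam ⟨η, hη.1⟩ :=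
      (isProlateSA_prolateSA hlam).1.2 rfl
    rw [eη]
    exact inner_prolateMax_comm_of_omegaForm_eq_zero ζ ⟨η, hη.1⟩ (hΩ η hη)
  rw [adjoint_prolateSA hlam, prolateSA_domain hlam] at hadj
  exact hadj

/-- RH-FREE (PROVED). **Eq. (1.15) as a theorem**: for `ζ ∈ dom W_max`,
`ζ ∈ 𝓛_β ↔ Ω(ζ, β₊) = Ω(ζ, β₋) = Ω(ζ, 𝓕β₊) = Ω(ζ, 𝓕β₋) = 0` — `𝓛_β = ⋂± Ker L_{β±} ∩ ⋂± Ker L_{β̂±}`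
with `L_θ = iΩ(·, θ)`; i.e. the boundary conditions (1.19)–(1.21) defining `dom W_sa` are exactly
these four linear conditions on `dom W_max`. [cite: ConnesMoscovici2022, §1 eq. (1.15) with (1.11) and Lemma 1.2 (v), and the Definition of `W_sa` (= arXiv:2112.05500 (2.15), chunk p0006:L1–L10, L52–L69)] -/
theorem mem_prolateSASet_iff_omegaForm_betaQuad_eq_zero (hlam : 0 < lam)
    (ζ : (prolateMax lam).domain) :
    (ζ : L2R) ∈ prolateSASet lam ↔ ∀ k : Fin 4, omegaForm lam ζ ⟨(![betaPlus lam hlam,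
      betaMinus lam hlam, (𝓕 (betaPlus lam hlam) : L2R), (𝓕 (betaMinus lam hlam) : L2R)] :
        Fin 4 → L2R) k, betaQuad_mem_prolateMax hlam k⟩ = 0 :=
  ⟨fun hζ k ↦ omegaForm_betaQuad_eq_zero_of_mem_prolateSASet hlam hζ k,
    mem_prolateSASet_of_omegaForm_betaQuad_eq_zero hlam ζ⟩

/-- RH-FREE (PROVED). **`𝓛_β` is Lagrangian**: for `ζ ∈ dom W_max`, `ζ ∈ 𝓛_β` iff `Ω(ζ, η) = 0`
for every `η ∈ 𝓛_β` («the selfadjoint extensions of `W_min` are parametrized by self-orthogonal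
subspaces of `ℰ`»; `𝓛_β / dom W_min` is maximal self-orthogonal). [cite: ConnesMoscovici2022, §1, the `ℰ`-paragraph after Lemma 1.3 and eq. (1.15) (= arXiv:2112.05500 §2, chunk p0005:L16–L21 and (2.15), p0006:L1–L10)] -/
theorem mem_prolateSASet_iff_forall_omegaForm_eq_zero (hlam : 0 < lam)
    (ζ : (prolateMax lam).domain) :
    (ζ : L2R) ∈ prolateSASet lam ↔
      ∀ (η : L2R) (hη : η ∈ prolateSASet lam), omegaForm lam ζ ⟨η, hη.1⟩ = 0 :=
  ⟨fun hζ _ hη ↦ omegaForm_eq_zero_of_mem_prolateSASet hlam hζ hη,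
    fun h ↦ mem_prolateSASet_of_omegaForm_betaQuad_eq_zero hlam ζ
      fun k ↦ h _ (betaQuad_mem_prolateSASet hlam k)⟩

/-! ## §2. The `𝓕`- and `𝓕⁻¹`-images of the four `β`'s lie in `𝓛_β` -/

/-- `𝓕⁻¹` of each of the four vectors lies in `𝓛_β`: `𝓕⁻¹β± ∈ 𝓛_β` (parity, seat cc-t10) and
`𝓕⁻¹𝓕β± = β±`. [cite: ConnesMoscovici2022, Thm 1.6, proof of (i), Fourier step: «since `β ∈ P_λ𝒮(ℝ)` one has `𝔽_{e_ℝ}β ∈ P̂_λ𝒮(ℝ) ⊂ Dom W_sa`» (= arXiv:2112.05500 Thm 2.6, chunk p0006:L85–L90)] -/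
theorem fourierInv_betaQuad_mem_prolateSASet (hlam : 0 < lam) (k : Fin 4) :
    (𝓕⁻ ((![betaPlus lam hlam, betaMinus lam hlam, (𝓕 (betaPlus lam hlam) : L2R),
      (𝓕 (betaMinus lam hlam) : L2R)] : Fin 4 → L2R) k) : L2R) ∈ prolateSASet lam := by
  fin_cases k
  · exact fourierInv_betaPlus_mem_prolateSASet hlam
  · exact fourierInv_betaMinus_mem_prolateSASet hlam
  · show (𝓕⁻ (𝓕 (betaPlus lam hlam) : L2R) : L2R) ∈ prolateSASet lam
    rw [fourierInv_fourier_eq]; exact betaPlus_mem_prolateSASet hlam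
  · show (𝓕⁻ (𝓕 (betaMinus lam hlam) : L2R) : L2R) ∈ prolateSASet lam
    rw [fourierInv_fourier_eq]; exact betaMinus_mem_prolateSASet hlam

/-- `𝓕` of each of the four vectors lies in `𝓛_β`: `𝓕β± ∈ 𝓛_β` and `𝓕𝓕β₊ = β₊`, `𝓕𝓕β₋ = −β₋`
(parity). [cite: ConnesMoscovici2022, Thm 1.6, proof of (i), Fourier step (= arXiv:2112.05500 Thm 2.6, chunk p0006:L85–L90)] -/
theorem fourier_betaQuad_mem_prolateSASet (hlam : 0 < lam) (k : Fin 4) :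
    (𝓕 ((![betaPlus lam hlam, betaMinus lam hlam, (𝓕 (betaPlus lam hlam) : L2R),
      (𝓕 (betaMinus lam hlam) : L2R)] : Fin 4 → L2R) k) : L2R) ∈ prolateSASet lam := by
  fin_cases k
  · exact fourier_betaPlus_mem_prolateSASet hlam
  · exact fourier_betaMinus_mem_prolateSASet hlam
  · show (𝓕 (𝓕 (betaPlus lam hlam) : L2R) : L2R) ∈ prolateSASet lam
    rw [← fourierInv_betaPlus hlam, fourier_fourierInv_eq]; exact betaPlus_mem_prolateSASet hlam
  · show (𝓕 (𝓕 (betaMinus lam hlam) : L2R) : L2R) ∈ prolateSASet lam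
    have h1 : (𝓕 (betaMinus lam hlam) : L2R) = -(𝓕⁻ (betaMinus lam hlam) : L2R) := by
      rw [fourierInv_betaMinus hlam, neg_neg]
    rw [h1, FourierTransform.fourier_neg, fourier_fourierInv_eq]
    exact (prolateSADomain lam hlam).neg_mem (betaMinus_mem_prolateSASet hlam)

/-! ## §3. Theorem 1.6 (i), second clause: `W_sa` commutes with the Fourier transform -/

/-- **`𝓛_β` is `𝓕`-invariant**: `ξ ∈ 𝓛_β ⇒ 𝓕ξ ∈ 𝓛_β` — by (1.15): `Ω(𝓕ξ, β) = Ω(ξ, 𝓕⁻¹β) = 0`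
for the four `β`'s since `𝓕⁻¹β ∈ 𝓛_β` (§2) and `Ω ≡ 0` on `𝓛_β × 𝓛_β`. [cite: ConnesMoscovici2022, Thm 1.6 (i) and its proof, Fourier step: «`Ω` globally invariant under the Fourier transform … `𝔽_{e_ℝ}β ∈ P̂_λ𝒮(ℝ) ⊂ Dom W_sa`» (= arXiv:2112.05500 Thm 2.6 (i), chunk p0006:L38–L44, L85–L90)] -/
theorem fourierL2_mem_prolateSASet (hlam : 0 < lam) {ξ : L2R} (hξ : ξ ∈ prolateSASet lam) :
    fourierL2 ξ ∈ prolateSASet lam := by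
  refine mem_prolateSASet_of_omegaForm_betaQuad_eq_zero hlam
    ⟨fourierL2 ξ, fourierL2_mem_prolateMax lam hξ.1⟩ fun k ↦ ?_
  exact (omegaForm_fourierL2_left lam ⟨ξ, hξ.1⟩ ⟨_, betaQuad_mem_prolateMax hlam k⟩).trans
    (omegaForm_eq_zero_of_mem_prolateSASet hlam hξ (fourierInv_betaQuad_mem_prolateSASet hlam k))

/-- `Ω(𝓕⁻¹ζ, η) = Ω(ζ, 𝓕η)` (invariance of `Ω` under `𝓕`, transported). [cite: ConnesMoscovici2022, §1 text before Thm 1.6: «the symplectic form `Ω` [is] globally invariant under the Fourier transform» (= arXiv:2112.05500 chunk p0006:L38–L44)] -/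
theorem omegaForm_fourierInv_left (lam : ℝ) (ζ η : (prolateMax lam).domain) :
    omegaForm lam ⟨(𝓕⁻ (ζ : L2R) : L2R), fourierInvL2_mem_prolateMax lam ζ.2⟩ η =
      omegaForm lam ζ ⟨fourierL2 (η : L2R), fourierL2_mem_prolateMax lam η.2⟩ := by
  have h := omegaForm_fourierL2 lam ⟨(𝓕⁻ (ζ : L2R) : L2R), fourierInvL2_mem_prolateMax lam ζ.2⟩ η
  have hmem := fourierL2_mem_prolateMax lam (fourierInvL2_mem_prolateMax lam ζ.2)
  have hsub : (⟨fourierL2 (𝓕⁻ (ζ : L2R) : L2R), hmem⟩ : (prolateMax lam).domain) = ζ :=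
    Subtype.ext (by simp only [fourierL2]; exact fourier_fourierInv_eq _)
  rw [hsub] at h
  exact h.symm

/-- **`𝓛_β` is `𝓕⁻¹`-invariant**: `ξ ∈ 𝓛_β ⇒ 𝓕⁻¹ξ ∈ 𝓛_β`. [cite: ConnesMoscovici2022, Thm 1.6 (i) and its proof, Fourier step (= arXiv:2112.05500 Thm 2.6 (i), chunk p0006:L38–L44, L85–L90)] -/
theorem fourierInvL2_mem_prolateSASet (hlam : 0 < lam) {ξ : L2R} (hξ : ξ ∈ prolateSASet lam) :
    (𝓕⁻ ξ : L2R) ∈ prolateSASet lam := by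
  refine mem_prolateSASet_of_omegaForm_betaQuad_eq_zero hlam
    ⟨(𝓕⁻ ξ : L2R), fourierInvL2_mem_prolateMax lam hξ.1⟩ fun k ↦ ?_
  exact (omegaForm_fourierInv_left lam ⟨ξ, hξ.1⟩ ⟨_, betaQuad_mem_prolateMax hlam k⟩).trans
    (omegaForm_eq_zero_of_mem_prolateSASet hlam hξ (fourier_betaQuad_mem_prolateSASet hlam k))

/-- `ξ ∈ 𝓛_β ↔ 𝓕ξ ∈ 𝓛_β`. [cite: ConnesMoscovici2022, Thm 1.6 (i) and its proof, Fourier step (= arXiv:2112.05500 Thm 2.6 (i), chunk p0006:L38–L44, L85–L90)] -/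
theorem fourierL2_mem_prolateSASet_iff (hlam : 0 < lam) (ξ : L2R) :
    fourierL2 ξ ∈ prolateSASet lam ↔ ξ ∈ prolateSASet lam := by
  refine ⟨fun h ↦ ?_, fourierL2_mem_prolateSASet hlam⟩
  have h' := fourierInvL2_mem_prolateSASet hlam h
  rwa [fourierL2, fourierInv_fourier_eq] at h'

/-- RH-FREE (PROVED). **[ConnesMoscovici2022, Thm 1.6 (i)], second clause: `W_sa` commutes with the
Fourier transform** — `𝓕` maps `dom W_sa = 𝓛_β` into itself and `W_sa(𝓕ξ) = 𝓕(W_sa ξ)` (the value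
clause is `W_max 𝓕 = 𝓕 W_max`, seat cc-t10). [cite: ConnesMoscovici2022, Thm 1.6 (i) and its proof: «both `W_min` and `W_max` commute with `𝔽_{e_ℝ}` … `Ω` globally invariant under the Fourier transform» (= arXiv:2112.05500 Thm 2.6 (i), chunk p0004:L29–L37, p0006:L38–L44, L76–L90)] -/
theorem commutesWith_prolateSA_fourierL2 (hlam : 0 < lam) :
    CommutesWith (prolateSA lam hlam) fourierL2 := by
  intro ξ
  have hξ : (ξ : L2R) ∈ prolateSASet lam := by
    rw [← mem_prolateSADomain hlam, ← prolateSA_domain hlam]; exact ξ.2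
  have hFξ : fourierL2 (ξ : L2R) ∈ prolateSASet lam := fourierL2_mem_prolateSASet hlam hξ
  have hdom : fourierL2 (ξ : L2R) ∈ (prolateSA lam hlam).domain := (prolateSA_domain hlam).symm.le hFξ
  refine ⟨hdom, ?_⟩
  have e1 : (prolateSA lam hlam ⟨fourierL2 (ξ : L2R), hdom⟩ : L2R) =
      prolateMax lam ⟨fourierL2 (ξ : L2R), hFξ.1⟩ := (isProlateSA_prolateSA hlam).1.2 rfl
  have e2 : (prolateSA lam hlam ξ : L2R) = prolateMax lam ⟨ξ, hξ.1⟩ :=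
    (isProlateSA_prolateSA hlam).1.2 rfl
  rw [e1, e2]
  exact prolateMax_fourierL2 lam ⟨ξ, hξ.1⟩

/-- … and with the inverse Fourier transform: `W_sa(𝓕⁻¹ξ) = 𝓕⁻¹(W_sa ξ)` on `𝓛_β`. [cite: ConnesMoscovici2022, Thm 1.6 (i) and its proof (= arXiv:2112.05500 Thm 2.6 (i), chunk p0004:L29–L37, p0006:L38–L44, L76–L90)] -/
theorem commutesWith_prolateSA_fourierInv (hlam : 0 < lam) :
    CommutesWith (prolateSA lam hlam) (fun ξ : L2R ↦ (𝓕⁻ ξ : L2R)) := by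
  intro ξ
  have hξ : (ξ : L2R) ∈ prolateSASet lam := by
    rw [← mem_prolateSADomain hlam, ← prolateSA_domain hlam]; exact ξ.2
  have hFξ : (𝓕⁻ (ξ : L2R) : L2R) ∈ prolateSASet lam := fourierInvL2_mem_prolateSASet hlam hξ
  have hdom : (𝓕⁻ (ξ : L2R) : L2R) ∈ (prolateSA lam hlam).domain := (prolateSA_domain hlam).symm.le hFξ
  refine ⟨hdom, ?_⟩
  obtain ⟨hmax, heq⟩ := fourierInv_mem_prolateMax lam ⟨ξ, hξ.1⟩
  have e1 : (prolateSA lam hlam ⟨(𝓕⁻ (ξ : L2R) : L2R), hdom⟩ : L2R) =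
      prolateMax lam ⟨(𝓕⁻ (ξ : L2R) : L2R), hmax⟩ := (isProlateSA_prolateSA hlam).1.2 rfl
  have e2 : (prolateSA lam hlam ξ : L2R) = prolateMax lam ⟨ξ, hξ.1⟩ :=
    (isProlateSA_prolateSA hlam).1.2 rfl
  rw [e1, e2]
  exact heq

/-- Clause-shaped: every `W` with `IsProlateSA λ W` (`λ > 0`) commutes with `𝓕`. [cite: ConnesMoscovici2022, Thm 1.6 (i) (= arXiv:2112.05500 Thm 2.6 (i), chunk p0006:L76–L90)] -/
theorem CM22_thm_1_6_i_fourier :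
    ∀ lam : ℝ, 0 < lam → ∀ W : L2R →ₗ.[ℂ] L2R, IsProlateSA lam W → CommutesWith W fourierL2 := by
  intro lam hlam W hW
  rw [hW.eq_prolateSA hlam]
  exact commutesWith_prolateSA_fourierL2 hlam

/-! ## §4. Theorem 1.6 (ii), the `P̂_λ`-half: `W_sa` commutes with `P̂_λ = 𝓕⁻¹ P_λ 𝓕` -/

/-- RH-FREE (PROVED). **[ConnesMoscovici2022, Thm 1.6 (ii)], `P̂_λ`-half: `W_sa` commutes with
`P̂_λ`** — in the tree `P̂_λ ξ = 𝓕⁻¹(P_λ(𝓕ξ))` (`cutoffProjHat_apply`), so this is the `P_λ`-half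
(`cutoffProj_mem_prolateSASet`, seat cc-t14 g3) conjugated by §3. [cite: ConnesMoscovici2022, Thm 1.6 (ii) and its proof, last sentence of the `P_λ` paragraph: «since `W_sa` commutes with `𝔽_{e_ℝ}` it also commutes with `P̂_λ`» (= arXiv:2112.05500 Thm 2.6 (ii), chunk p0006:L76–L79, L83–L90)] -/
theorem commutesWith_prolateSA_cutoffProjHat (hlam : 0 < lam) :
    CommutesWith (prolateSA lam hlam) (cutoffProjHat lam) := by
  intro ξ
  have hξ : (ξ : L2R) ∈ prolateSASet lam := by
    rw [← mem_prolateSADomain hlam, ← prolateSA_domain hlam]; exact ξ.2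
  -- `𝓕ξ ∈ 𝓛_β`
  have h1 : fourierL2 (ξ : L2R) ∈ prolateSASet lam := fourierL2_mem_prolateSASet hlam hξ
  -- `P_λ 𝓕ξ ∈ 𝓛_β`, `W_max(P_λ 𝓕ξ) = P_λ W_max(𝓕ξ)`
  obtain ⟨h2dom, h2eq, h2⟩ := cutoffProj_mem_prolateSASet hlam ⟨fourierL2 (ξ : L2R), h1.1⟩ h1
  -- `𝓕⁻¹ P_λ 𝓕 ξ ∈ 𝓛_β`, `W_max(𝓕⁻¹ ·) = 𝓕⁻¹ W_max(·)`
  have h3 : (𝓕⁻ (cutoffProj lam (fourierL2 (ξ : L2R))) : L2R) ∈ prolateSASet lam :=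
    fourierInvL2_mem_prolateSASet hlam h2
  obtain ⟨h3dom, h3eq⟩ := fourierInv_mem_prolateMax lam ⟨cutoffProj lam (fourierL2 (ξ : L2R)), h2dom⟩
  have hdom : cutoffProjHat lam (ξ : L2R) ∈ (prolateSA lam hlam).domain := by
    rw [cutoffProjHat_apply]; exact (prolateSA_domain hlam).symm.le h3
  refine ⟨hdom, ?_⟩
  have e1 : (prolateSA lam hlam ⟨cutoffProjHat lam (ξ : L2R), hdom⟩ : L2R) =
      prolateMax lam ⟨(𝓕⁻ (cutoffProj lam (fourierL2 (ξ : L2R))) : L2R), h3dom⟩ :=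
    (isProlateSA_prolateSA hlam).1.2 rfl
  have e2 : (prolateSA lam hlam ξ : L2R) = prolateMax lam ⟨ξ, hξ.1⟩ :=
    (isProlateSA_prolateSA hlam).1.2 rfl
  have e3 : prolateMax lam ⟨fourierL2 (ξ : L2R), h1.1⟩ =
      fourierL2 (prolateMax lam ⟨ξ, hξ.1⟩) := prolateMax_fourierL2 lam ⟨ξ, hξ.1⟩
  try dsimp only at h2eq h3eq
  rw [e1, e2, h3eq, h2eq, e3, cutoffProjHat_apply]
  rfl

/-- Clause-shaped: every `W` with `IsProlateSA λ W` (`λ > 0`) commutes with `P̂_λ`. [cite: ConnesMoscovici2022, Thm 1.6 (ii) (= arXiv:2112.05500 Thm 2.6 (ii), chunk p0006:L76–L79)] -/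
theorem CM22_thm_1_6_ii_cutoffProjHat :
    ∀ lam : ℝ, 0 < lam → ∀ W : L2R →ₗ.[ℂ] L2R, IsProlateSA lam W →
      CommutesWith W (cutoffProjHat lam) := by
  intro lam hlam W hW
  rw [hW.eq_prolateSA hlam]
  exact commutesWith_prolateSA_cutoffProjHat hlam

/-! ## §5. Theorem 1.6: the named fact discharged -/

/-- RH-FREE (PROVED). **[ConnesMoscovici2022, Theorem 1.6] holds**: «(i) `W_sa` is selfadjoint and
commutes with the Fourier transform. (ii) `W_sa` commutes with the projections `P_λ` and `P̂_λ`.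
(iii) `W_sa` is the only selfadjoint extension of `W_min` commuting with `P_λ` and `P̂_λ`. (iv) The
spectrum of `W_sa` is discrete and unbounded on both sides.» — the named fact `CM22_thm_1_6` AS TYPED
(for every `λ > 0` and every `W` with `IsProlateSA λ W`), assembled through seat cc-t8's socket
`CM22_thm_1_6_of_fourier` from §3–§4; all other conjuncts are tree theorems of
`UVProlateSADomainStructure` / `UVProlateCutoffCommutation` / `UVProlateGreenResolvent`.
[cite: ConnesMoscovici2022, Thm 1.6 (i)–(iv) and its proof (= arXiv:2112.05500 Thm 2.6, chunk p0006:L76–L79; proof L81–L114)] -/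
theorem CM22_thm_1_6_holds : CM22_thm_1_6 :=
  CM22_thm_1_6_of_fourier (fun _ hlam ↦ commutesWith_prolateSA_fourierL2 hlam)
    (fun _ hlam ↦ commutesWith_prolateSA_cutoffProjHat hlam)

/-- `W_sa` has compact resolvent at every non-real `z` (seat cc-t15's theorem fed with the tree's
self-adjointness of `W_sa`). [cite: ConnesMoscovici2022, Thm 1.6 (iv), proof: «`(W_sa + i)⁻¹` … is a compact operator» (= arXiv:2112.05500 Thm 2.6 (iv), chunk p0006:L95–L114)] -/
theorem isCompactOperator_resolvent_prolateSA (hlam : 0 < lam) {z : ℂ} (hz : z.im ≠ 0) :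
    IsCompactOperator (resolvent (isSelfAdjoint_prolateSA hlam) hz) :=
  isCompactOperator_resolvent_of_isProlateSA hlam (isProlateSA_prolateSA hlam) _ hz

end Literature.NumberTheory.ConnesMoscovici2022

end
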